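/-
Copyright: the pub-balaban-gaps cell (G2 seat ne6, gen 8; row NE7b), for the b2b-balaban T⁴-continuum CRUX team's row-NE7b
OWNER lineage `t4-ne7b-p1` (re-cut W-ne7bp1-g103-1∕-2) and its refuter desk (PRICING-NE7b F338). Project licence.
-/
import Summits.QuantumFields.BalabanUV.T4Continuum.Spine.NE7b.PrefixExtractionLaws
import Mathlib.Analysis.SpecialFunctions.Gaussian.GaussianIntegral

/-!
# LOCAL CONDITIONAL STABILITY at a pinned step («LCS-j»): the ONE residual one-step lemma of Bałaban's kind on row NE7b's
# re-cut road, TYPED AS TWO NAMED PROPS over the abstract history tower, with the kernel junction to the one-step display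
# `hrel` of `…NE7b.PrefixExtraction` and to `PinnedExtraction.ExtractionLaws` (row NE7b, node U5c; statement-first)

Cell `pub-balaban`, sub-cell `t4`, spine estimate NE7b (`T4WeightBudget.RelWeightBound`, the cell's OWN estimate — NOT
PRINTED in [Bałaban 1983–89], NOT PROVED).  Crux-route work under `Spine/NE7b/`; it types NO `T4Continuum/Support` leaf,
mints no `Prop` of Bałaban's (the two `Prop`s below are stated over the ABSTRACT tower `B16HistoryReprChain.Tower` of
IR-97-2 and name no object of [B15]∕[B16]), carries no `[cite:]` tag; zero `sorry`.

WHY.  After `…NE7b.PrefixExtraction` (p355490) ∕ `…NE7b.PrefixExtractionLaws` (p355775) the K-step per-class display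
`PinnedExtraction.ExtractionLaws.extract` of the re-cut road (IR-103-1 `Support/B16HistoryTowerExtractionDataLWR.extractA`)
FOLLOWS from ONE-STEP relative event displays `hrel` per (pinned step, pattern prefix).  The refuter priced what `hrel` owes
for Bałaban's tower (PRICING-NE7b v61, F338 ★): ONE residual lemma «LCS-j» = local conditional stability at a pinned step —
(i) POINTWISE EXTRACTION, print VERBATIM in kind ([Balaban1989LargeFieldI] p. 175 (0.1) «The term in the Wilson action,
corresponding to the plaquette p, gives the estimate» `exp(−g₀⁻²[1 − Re tr U(∂p)]) ≤ exp(−p₀(g₀))`; [Balaban1989LargeFieldII]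
p. 383 «we estimate the factors by exp(−p₀(g_j))»; for φ⁴₃ Dimock, *The renormalization group according to Balaban III*,
arXiv:1304.0705, §3.3 (158)∕(163) «split each exponential into two factors …; the first is estimated to give small factors and
the second is integrated over») — a Chebyshev split `χ ≤ e^{−a}·e^{δQ}` of the pinned event's characteristic function against
a part `e^{δQ}` of the term's own action; and (ii) the SAME term's LOCALISED EXPONENTIAL MOMENT `E_{j,g}(e^{δQ_{j,Z}}) ≤ e^{O(1)|Z|}` uniformly in the running
coupling — print's KIND (the 𝐑-quotients of [Balaban1989LargeFieldI] (0.3)–(0.5) p. 176–177 «determined by small field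
effective actions only»; Dimock III §3.4 (184) «the change of variables W → √2 W takes us back to a probability measure» =
a factor `2^{n∕2}` for a halved Gaussian, and (186)∕(191): a per-site cost `O(1)(−log λ_j)` for the bounded fluctuation
fields, still beaten by the extracted `p_j²`) — NOT PRINTED AS A STATEMENT for [B16]'s densities.  THIS FILE gives the two
halves NAMES in the tower's `hstep` currency (IR-102-1; `PrefixExtraction.hrel_of_hstep`) and proves the junction, so that the
row's first missing lemma of Bałaban's kind is ONE NAMED `Prop` (`LocCondStability`, inequality AND integrability) to be inhabited
by the (A1c) instance, the other half (`PointwiseExtraction`) being the Chebyshev split PROVED here as a lemma of real analysis.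

WHAT IS PROVED ([folklore]; finite sums, Bochner monotonicity, one Gaussian integral; nothing of Bałaban's named):
* §1 **`chebyshev_extraction`**: characteristic functions with `Σ_i χ_i ≤ 1`, each supported in `{θ ≤ Q}`, satisfy
  `Σ_i χ_i ≤ e^{−δθ}·e^{δQ}` pointwise (`0 ≤ δ`) — print's «we estimate the factors by exp(−p₀(g_j))» as a lemma.
* §2 the two halves as `Prop`s over ONE tower `T`, pattern `S`, cutoff `K`, levels `μ j`, term family `eterm ρ₀`:
  **`PointwiseExtraction T S K χ M a`** (`Σ_{p ∈ branch j g ∩ S j g} χ j g p ≤ e^{−a j g}·M j g` pointwise, at the pattern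
  prefixes of the levels `j < K`) and **`LocCondStability T S K μ ρ₀ M b`** (`∫ M j g·eterm j g dμ_j ≤ e^{b j g}·∫ eterm j g dμ_j`
  there, WITH the integrability of `M j g·eterm j g` as a conjunct: the moment carrier `M` has FINITE conditional expectation
  `≤ e^{b}` in the history term's OWN state); `sumAlong` (the sum of
  per-step exponents along a history) with `wAlong_exp` (`wAlong (e^{f}) = e^{sumAlong f}`); `unpinned_extraction` ∕
  `unpinned_stability` (at an unpinned level the decomposition of unity gives both halves with exponents `0`, carrier `1`).
* §3 **`hrel_of_LCS`** (the `hstep` identities + the two halves ⟹ `hrel` at every pattern prefix with rate `e^{b−a}`);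
  **`sum_admS_integral_le_of_LCS`** (⟹ the pattern class's level-`K` weight `≤ e^{−c}·∫ρ₀ dμ_0` once the COST–VOLUME
  inequality `c ≤ Σ_{j<K} (a − b)` holds along every pattern history — the Peierls bookkeeping «extracted cost beats the
  stability volume cost», the cell's count); **`extractionLaws_of_LCS_of_subset`** (the KEYED `PinnedExtraction.ExtractionLaws`
  of the road's records from the two halves per (cutoff, key, level), quotient `e^{Σ_{j<K}(b − a)}`).
* §4 MODEL (one real Gaussian variable; says NOTHING about Bałaban's densities): **`gaussian_partial_moment`**
  (`∫ e^{δβx²}e^{−βx²} dx = (√(1−δ))⁻¹·∫ e^{−βx²} dx` for `0 < β`, `δ < 1` — the halved-action moment is `β`-FREE: Dimock III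
  (184)'s sentence in kernel form) and **`gaussian_partial_moment_shift`** (with an exterior mismatch `m`:
  `∫ e^{δβ(x−m)²}e^{−βx²} dx = (√(1−δ))⁻¹·e^{δβm²∕(1−δ)}·∫ e^{−βx²} dx` — `β`-uniform iff `βm² = O(1)`, i.e. a SMALL-FIELD
  exterior in the scaled sense: the located reason the LCS denominators must be «determined by small field effective actions
  only» and why the refuter's cost line carries «(A1c) cover routing of births adjacent to live components»).
* §5 Sanity (decided toy on `B16HistoryReprInstance.toyT`, Dirac levels): the `hstep` identities, both halves and the cost–volume
  constant are JOINTLY inhabited and `sum_admS_integral_le_of_LCS` gives `15 ≤ e^{log 3 + log 5}·1 = 15` — attained.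

NOT HERE (honest).  An INHABITANT of `LocCondStability` for Bałaban's tower (the (A1c) instance: `T :=` the 𝐑𝐓 steps at the
live index, `M j g := e^{δQ_{j,Z}}` the part of the effective action sacrificed on the pinned event's region, `b = O(1)|Z|` or
`O(log g_j⁻²)|Z|`) — NC-NE7b-α UNRULED; the READING `fibre … ⊆ badx …` (leaf-02's α1–α4); the count.  BY-NAME EFFECT ON THE
WALL: the residual of Bałaban's kind on the re-cut road is now ONE NAMED `Prop` per (pinned step, prefix) — `LocCondStability`
— with its print loci; nothing is discharged.  NE7b NOT PRINTED ∕ NOT PROVED; spine PROVED 0∕9; rung (B)+1 on a FINITE torus —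
NOT infinite volume, NOT the mass gap, NOT Clay.
HONEST DEPENDENCY: continuum YM on T⁴ ⇐ BetaPertH ∧ nine spine estimates (0/9 proved); BetaPertH ⇐ (D1) ∧ (D4) ∧ CAP+tail.
-/

set_option autoImplicit false

open Finset MeasureTheory Real
open Summit.QuantumFields.BalabanUV.T4Continuum.B16HistoryIndexedRepr Summit.QuantumFields.BalabanUV.T4Continuum.B16HistoryReprChain
open Summit.QuantumFields.BalabanUV.T4Continuum.B16HistoryReprInstance Summit.QuantumFields.BalabanUV.T4Continuum.NE7b.PinnedExtraction
open Summit.QuantumFields.BalabanUV.T4Continuum.NE7b.PrefixExtraction Summit.QuantumFields.BalabanUV.T4Continuum.NE7b.PrefixExtractionLaws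

namespace Summit.QuantumFields.BalabanUV.T4Continuum.NE7b.LocalConditionalStability

/-! ## §1 Print's pointwise mechanism as a lemma: the Chebyshev split of a characteristic function -/

section Chebyshev

variable {X ι : Type*}

/-- **«WE ESTIMATE THE FACTORS BY exp(−p₀(g_j))» AS A LEMMA.**  Characteristic functions `χ i` (`i ∈ s`) summing pointwise
to at most `1`, each supported where the functional `Q` is at least the threshold `θ`, satisfy
`Σ_{i ∈ s} χ i y ≤ e^{−δθ} · e^{δ·Q y}` for every `δ ≥ 0`: the event's characteristic function is small AGAINST the part
`e^{δQ}` of the density one is willing to sacrifice ([Balaban1989LargeFieldI] (0.1) p. 175; [Balaban1989LargeFieldII] p. 383;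
Dimock III (158)∕(163) — LOCATORS; a statement of real analysis). [folklore] -/
theorem chebyshev_extraction (s : Finset ι) (χ : ι → X → ℝ) (Q : X → ℝ) {θ δ : ℝ} (hδ : 0 ≤ δ)
    (hχ1 : ∀ y, ∑ i ∈ s, χ i y ≤ 1) (hsupp : ∀ i ∈ s, ∀ y, χ i y ≠ 0 → θ ≤ Q y) (y : X) :
    ∑ i ∈ s, χ i y ≤ exp (-(δ * θ)) * exp (δ * Q y) := by
  by_cases h : ∃ i ∈ s, χ i y ≠ 0
  · obtain ⟨i, hi, hne⟩ := h
    have hQ : θ ≤ Q y := hsupp i hi y hne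
    calc ∑ i ∈ s, χ i y ≤ 1 := hχ1 y
      _ ≤ exp (-(δ * θ)) * exp (δ * Q y) := by
          rw [← exp_add]
          exact one_le_exp (by nlinarith)
  · push Not at h
    rw [Finset.sum_eq_zero fun i hi => h i hi]
    positivity

/-- The one-function case: a characteristic function `χ ≤ 1` supported in `{θ ≤ Q}` is at most `e^{−δθ}·e^{δQ}`. [folklore] -/
theorem chebyshev_extraction_single (χ Q : X → ℝ) {θ δ : ℝ} (hδ : 0 ≤ δ) (hχ1 : ∀ y, χ y ≤ 1)
    (hsupp : ∀ y, χ y ≠ 0 → θ ≤ Q y) (y : X) : χ y ≤ exp (-(δ * θ)) * exp (δ * Q y) := by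
  simpa using chebyshev_extraction ({()} : Finset Unit) (fun _ => χ) Q hδ (by simpa using hχ1) (fun _ _ => hsupp) y

end Chebyshev

/-! ## §2 The two halves of «LCS-j» as named `Prop`s over one history tower -/

section Halves

variable {P : Type} [DecidableEq P] {C : ℕ → Type} {𝒢 : (j : ℕ) → GoodClass (C j)}

/-- **POINTWISE EXTRACTION** (half (i) of «LCS-j», print VERBATIM in kind): at every pattern prefix `g` of a level `j < K`, the
`hstep`-characteristic functions of the PINNED next choices sum pointwise to at most `e^{−a j g}` times a MOMENT CARRIER
`M j g` (for Bałaban's tower: `a` = the extracted exponent `p₀(g_j)` ∕ the rounded renewal exponent, `M = e^{δQ_{j,Z}}` the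
sacrificed part of the action on the event's region — (A1c)'s to name; `chebyshev_extraction` discharges it from a support
condition when the pinned event is an event of the level-`j` variable `y`).  For the 𝐑𝐓 step, whose pinned event lives on the
step's FRESH (fluctuation) variables, the split is made INSIDE the one-step kernel `k(y, ·)` of the `hstep` identity: there
`χ j g p y = ∫ 𝟙_{event p}(y, z) k(y, dz)` is a transition weight, `chebyshev_extraction` is applied under the kernel integral,
and the carrier is the KERNEL-CONDITIONAL moment `M j g y := ∫ 𝟙⁺_Z(y, z)·e^{δQ_{j,Z}(y, z)} k(y, dz)` — so (i) holds by the
definition of `M` and ALL the content sits in (ii) for that `M` (refuter PRICING-NE7b v63, ρ-ne7bref-g63-2; F338's form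
carried `χ⁺_Z` inside the moment for this reason).  At an unpinned level take `a = 0`, `M = 1` (decomposition of unity). [folklore] -/
def PointwiseExtraction (T : Tower P C 𝒢) (S : (j : ℕ) → (Fin j → P) → Finset P) (K : ℕ)
    (χ : (j : ℕ) → (Fin j → P) → P → C j → ℝ) (M : (j : ℕ) → (Fin j → P) → C j → ℝ)
    (a : (j : ℕ) → (Fin j → P) → ℝ) : Prop :=
  ∀ j g, j < K → g ∈ admS T S j → ∀ y, ∑ p ∈ T.branch j g ∩ S j g, χ j g p y ≤ exp (-a j g) * M j g y

/-- **LOCAL CONDITIONAL STABILITY** (half (ii) of «LCS-j» — THE residual of Bałaban's kind on the re-cut road): at every pattern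
prefix `g` of a level `j < K`, the moment carrier has conditional expectation at most `e^{b j g}` in the history term's OWN
state, `∫ M j g · eterm j g dμ_j ≤ e^{b j g} · ∫ eterm j g dμ_j` (for Bałaban's tower: `b = O(1)·|Z|` — uniformly in the running
coupling, the whole content — or `O(log g_j⁻²)·|Z|` as in Dimock III (186), either beaten by `a`; print's KIND —
[Balaban1989LargeFieldI] (0.3)–(0.5) p. 176–177, Dimock III §3.4 (184)∕(187) — NOT print's statement).  Print's BY-VALUE
form of this half is [Balaban1989LargeFieldII] p. 383 l. 21–28 «The integrals with respect to the fields A_j … are estimated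
using the positivity properties of the quadratic forms, and we get the factors exp O(1)|Z_j ∩ Ω_j|» (typed AS PRINTED:
`B16Ineq179.Txt383.afield_le`, the ABSOLUTE factor inside the product bound (1.79); the p. 380 «constant with the
logarithms» is its `log g_j⁻²` companion, `B16StepFactorsPrinted`'s (V)); `LocCondStability` asks the SAME factor RELATIVE to
the un-pinned term in its own state — the currency forced by F-ne7bp1-g103-1∕2 — which print does not state — TOGETHER WITH
ITS FINITENESS: the conjunct `Integrable (M j g · eterm j g) (μ j)` is part of the named `Prop` (without it the Bochner
convention `∫ = 0` would let any non-integrable carrier inhabit the inequality — chair leaf-05 g131 π-X-LCS-1, repair (a);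
refuter E-ne7bref-g63-2 CONCUR).  At an unpinned level take `b = 0`. [folklore] -/
def LocCondStability (T : Tower P C 𝒢) (S : (j : ℕ) → (Fin j → P) → Finset P) (K : ℕ) [∀ j, MeasurableSpace (C j)]
    (μ : (j : ℕ) → Measure (C j)) (ρ₀ : C 0 → ℝ) (M : (j : ℕ) → (Fin j → P) → C j → ℝ)
    (b : (j : ℕ) → (Fin j → P) → ℝ) : Prop :=
  ∀ j g, j < K → g ∈ admS T S j →
    Integrable (fun y => M j g y * T.eterm ρ₀ j g y) (μ j) ∧
      ∫ y, M j g y * T.eterm ρ₀ j g y ∂μ j ≤ exp (b j g) * ∫ y, T.eterm ρ₀ j g y ∂μ j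

/-- **THE SUM OF PER-STEP EXPONENTS ALONG A HISTORY** (`sumAlong (K+1) h = sumAlong K h|_K + f K h|_K`). [folklore] -/
def sumAlong (f : (j : ℕ) → (Fin j → P) → ℝ) : (K : ℕ) → (Fin K → P) → ℝ
  | 0, _ => 0
  | K + 1, h => sumAlong f K (Fin.init h) + f K (Fin.init h)

omit [DecidableEq P] in
/-- The product of the factors `e^{f}` along a history is `e^{sumAlong f}`. [folklore] -/
theorem wAlong_exp (f : (j : ℕ) → (Fin j → P) → ℝ) :
    ∀ (K : ℕ) (h : Fin K → P), Tower.wAlong (fun j g _ => exp (f j g)) K h = exp (sumAlong f K h)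
  | 0, _ => by simp [Tower.wAlong, sumAlong]
  | K + 1, h => by
      show Tower.wAlong (fun j g _ => exp (f j g)) K (Fin.init h) * exp (f K (Fin.init h)) =
        exp (sumAlong f K (Fin.init h) + f K (Fin.init h))
      rw [wAlong_exp f K (Fin.init h), exp_add]

omit [DecidableEq P] in
/-- `sumAlong` is additive in the exponent family. [folklore] -/
theorem sumAlong_sub (a b : (j : ℕ) → (Fin j → P) → ℝ) :
    ∀ (K : ℕ) (h : Fin K → P), sumAlong (fun j g => b j g - a j g) K h = sumAlong b K h - sumAlong a K h
  | 0, _ => by simp [sumAlong]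
  | K + 1, h => by
      show sumAlong (fun j g => b j g - a j g) K (Fin.init h) + (b K (Fin.init h) - a K (Fin.init h)) = _
      rw [sumAlong_sub a b K (Fin.init h)]
      simp only [sumAlong]
      ring

/-- **AN UNPINNED LEVEL, half (i)**: where the pattern admits every admissible choice, non-negative `hstep`-characteristic
functions forming a decomposition of unity (IR-102-1's `hunit`) give the pointwise-extraction inequality with exponent `0` and
carrier `1` — nothing is extracted, nothing sacrificed. [folklore] -/
theorem unpinned_extraction {X : Type*} (s S : Finset P) (χ : P → X → ℝ) (y : X) (hχ0 : ∀ p ∈ s, 0 ≤ χ p y)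
    (hunit : ∑ p ∈ s, χ p y = 1) : ∑ p ∈ s ∩ S, χ p y ≤ exp (-0) * 1 := by
  rw [neg_zero, exp_zero, one_mul, ← hunit]
  exact Finset.sum_le_sum_of_subset_of_nonneg Finset.inter_subset_left fun p hp _ => hχ0 p hp

/-- **AN UNPINNED LEVEL, half (ii)**: the carrier `1` (times an integrable term) is integrable and has conditional expectation
`e^{0}`. [folklore] -/
theorem unpinned_stability {X : Type*} [MeasurableSpace X] (μ : Measure X) (e : X → ℝ) (he : Integrable e μ) :
    Integrable (fun y => 1 * e y) μ ∧ ∫ y, 1 * e y ∂μ ≤ exp 0 * ∫ y, e y ∂μ :=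
  ⟨by simpa using he, by simp⟩

end Halves

/-! ## §3 The junction: the two halves give `hrel`, the class display, and the road's `ExtractionLaws` -/

section Junction

variable {P : Type} [DecidableEq P] {C : ℕ → Type} {𝒢 : (j : ℕ) → GoodClass (C j)} {T : Tower P C 𝒢}
  {S : (j : ℕ) → (Fin j → P) → Finset P} [∀ j, MeasurableSpace (C j)] {μ : (j : ℕ) → Measure (C j)} {ρ₀ : C 0 → ℝ}
  {K : ℕ} {χ : (j : ℕ) → (Fin j → P) → P → C j → ℝ} {M : (j : ℕ) → (Fin j → P) → C j → ℝ}
  {a b : (j : ℕ) → (Fin j → P) → ℝ}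

/-- **«LCS-j» GIVES THE ONE-STEP DISPLAY.**  On a tower whose one-step maps carry the per-(step, choice) integral identities of
IR-102-1 (`hstep : ∫ (op j g p) f dμ_{j+1} = ∫ χ_{j,g,p}·f dμ_j` for good `f`), pointwise extraction with exponents `a` and
carrier `M` plus local conditional stability of `M` with exponents `b` (which carries the carrier's integrability) and the
integrability display for the `χ`'s give `hrel` at every pattern prefix of every level `j < K` with rate `ε j g = e^{b j g − a j g}`.
[folklore] -/
theorem hrel_of_LCS (hρ : (𝒢 0).Gd ρ₀) (h0 : ∀ x, 0 ≤ ρ₀ x)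
    (hstep : ∀ j g, j < K → g ∈ admS T S j → ∀ p ∈ T.branch j g, ∀ f : C j → ℝ, (𝒢 j).Gd f →
      ∫ x, (T.op j g p).T f x ∂μ (j + 1) = ∫ y, χ j g p y * f y ∂μ j)
    (hintχ : ∀ j g, j < K → g ∈ admS T S j → ∀ p ∈ T.branch j g,
      Integrable (fun y => χ j g p y * T.eterm ρ₀ j g y) (μ j))
    (hPE : PointwiseExtraction T S K χ M a) (hLCS : LocCondStability T S K μ ρ₀ M b) :
    ∀ j g, j < K → g ∈ admS T S j →
      ∑ p ∈ T.branch j g ∩ S j g, ∫ x, (T.op j g p).T (T.eterm ρ₀ j g) x ∂μ (j + 1) ≤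
        exp (b j g - a j g) * ∫ x, T.eterm ρ₀ j g x ∂μ j := by
  intro j g hj hg
  obtain ⟨hintM, hLCSjg⟩ := hLCS j g hj hg
  refine hrel_of_hstep hρ (χ j g) (hstep j g hj hg) (hintχ j g hj hg) ?_
  have hsub : T.branch j g ∩ S j g ⊆ T.branch j g := Finset.inter_subset_left
  have hlhs : Integrable (fun y => (∑ p ∈ T.branch j g ∩ S j g, χ j g p y) * T.eterm ρ₀ j g y) (μ j) := by
    have := integrable_finsetSum (T.branch j g ∩ S j g) fun p hp => hintχ j g hj hg p (hsub hp)
    refine this.congr (Filter.Eventually.of_forall fun y => ?_)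
    simp only [Finset.sum_mul]
  calc ∫ y, (∑ p ∈ T.branch j g ∩ S j g, χ j g p y) * T.eterm ρ₀ j g y ∂μ j
      ≤ ∫ y, exp (-a j g) * (M j g y * T.eterm ρ₀ j g y) ∂μ j := by
        refine integral_mono hlhs (hintM.const_mul _) fun y => ?_
        have he : 0 ≤ T.eterm ρ₀ j g y := T.eterm_nonneg hρ h0 j g y
        calc (∑ p ∈ T.branch j g ∩ S j g, χ j g p y) * T.eterm ρ₀ j g y
            ≤ (exp (-a j g) * M j g y) * T.eterm ρ₀ j g y := mul_le_mul_of_nonneg_right (hPE j g hj hg y) he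
          _ = exp (-a j g) * (M j g y * T.eterm ρ₀ j g y) := by ring
    _ = exp (-a j g) * ∫ y, M j g y * T.eterm ρ₀ j g y ∂μ j := integral_const_mul _ _
    _ ≤ exp (-a j g) * (exp (b j g) * ∫ y, T.eterm ρ₀ j g y ∂μ j) :=
        mul_le_mul_of_nonneg_left hLCSjg (exp_pos _).le
    _ = exp (b j g - a j g) * ∫ x, T.eterm ρ₀ j g x ∂μ j := by
        rw [← mul_assoc, ← exp_add, sub_eq_neg_add]

/-- **THE CLASS DISPLAY FROM «LCS-j» UNDER THE COST–VOLUME INEQUALITY.**  With the hypotheses of `hrel_of_LCS` and the Peierls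
bookkeeping `c ≤ sumAlong a K h − sumAlong b K h` along every pattern history `h` of length `K` («the extracted cost beats the
stability volume cost by `c`»), the pattern class's level-`K` weight is at most `e^{−c} · ∫ ρ₀ dμ_0`. [folklore] -/
theorem sum_admS_integral_le_of_LCS (hρ : (𝒢 0).Gd ρ₀) (h0 : ∀ x, 0 ≤ ρ₀ x)
    (hstep : ∀ j g, j < K → g ∈ admS T S j → ∀ p ∈ T.branch j g, ∀ f : C j → ℝ, (𝒢 j).Gd f →
      ∫ x, (T.op j g p).T f x ∂μ (j + 1) = ∫ y, χ j g p y * f y ∂μ j)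
    (hintχ : ∀ j g, j < K → g ∈ admS T S j → ∀ p ∈ T.branch j g,
      Integrable (fun y => χ j g p y * T.eterm ρ₀ j g y) (μ j))
    (hPE : PointwiseExtraction T S K χ M a) (hLCS : LocCondStability T S K μ ρ₀ M b) {c : ℝ}
    (hcost : ∀ h ∈ admS T S K, c ≤ sumAlong a K h - sumAlong b K h) :
    ∑ h ∈ admS T S K, ∫ x, T.eterm ρ₀ K h x ∂μ K ≤ exp (-c) * ∫ x, ρ₀ x ∂μ 0 := by
  refine sum_admS_integral_le_of_wAlong T S μ ρ₀ (fun j g => exp (b j g - a j g)) hρ h0 (fun j g => exp_pos _) K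
    (hrel_of_LCS hρ h0 hstep hintχ hPE hLCS) (exp_pos _).le fun h hh => ?_
  rw [wAlong_exp, sumAlong_sub]
  exact exp_le_exp.2 (by linarith [hcost h hh])

end Junction

section Laws

variable {P : Type} [DecidableEq P] {C : ℕ → ℕ → Type} {𝒢 : (K j : ℕ) → GoodClass (C K j)}
  (T : (K : ℕ) → Tower P (C K) (𝒢 K)) (p₀ : ℕ → ℕ → P)
  (ρ₀ : (K : ℕ) → ℝ → C K 0 → ℝ) (hρ : ∀ K t, (𝒢 K 0).Gd (ρ₀ K t)) (h0 : ∀ K t x, 0 ≤ ρ₀ K t x)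
  (B : ℕ → ℝ → ℝ) (hB : ∀ K t, 0 < B K t) [∀ K j, MeasurableSpace (C K j)] (ν : (K j : ℕ) → Measure (C K j))
  {α : Type*} (S : (K : ℕ) → α → (j : ℕ) → (Fin j → P) → Finset P)
  (χ : (K : ℕ) → α → (j : ℕ) → (Fin j → P) → P → C K j → ℝ) (M : (K : ℕ) → α → ℝ → (j : ℕ) → (Fin j → P) → C K j → ℝ)
  (a b : ℕ → α → ℕ → ℝ)

/-- **THE ROAD's KEYED EXTRACTION LAWS FROM «LCS-j».**  For the cutoff family of towers of the re-cut road's records: sub-classes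
`Badx K x` covering the bad class on the source window and READ INTO pattern classes (`hread`, leaf-02's pen), the `hstep`
identities, POINTWISE EXTRACTION with per-(cutoff, key, level) exponents `a K x j` and LOCAL CONDITIONAL STABILITY with
exponents `b K x j` at the pattern prefixes (the carrier `M K x t` may depend on the source value; its integrability against the
term rides inside `LocCondStability`), plus the telescoping ∕
integrability displays on the window, give `PinnedExtraction.ExtractionLaws` for run A's weights with quotients
`q K x = Π_{j<K} e^{b K x j − a K x j}` — `extractionLaws_of_prefix_of_subset` ∘ `hrel_of_LCS`. [folklore] -/
theorem extractionLaws_of_LCS_of_subset {l₀ : ℝ} (Bad : ℕ → ℝ → Finset (HIndex.Idx (skelFam T p₀)))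
    (X : ℕ → Finset α) (Badx : ℕ → α → Finset (HIndex.Idx (skelFam T p₀)))
    (hp₀ : ∀ K j g, p₀ K j ∈ (T K).branch j g)
    (bad_subset : ∀ K t, |t| ≤ l₀ → Bad K t ⊆ HIndex.termSet (skelFam T p₀) K)
    (cover : ∀ K t, |t| ≤ l₀ → ∀ τ ∈ Bad K t, ∃ x ∈ X K, τ ∈ Badx K x)
    (hread : ∀ K, ∀ x ∈ X K, Badx K x ⊆ badx T p₀ S K x)
    (hstep : ∀ K t, |t| ≤ l₀ → ∀ x ∈ X K, ∀ j g, j < K → g ∈ admS (T K) (S K x) j → ∀ p ∈ (T K).branch j g,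
      ∀ f : C K j → ℝ, (𝒢 K j).Gd f → ∫ y, ((T K).op j g p).T f y ∂ν K (j + 1) = ∫ y, χ K x j g p y * f y ∂ν K j)
    (hintχ : ∀ K t, |t| ≤ l₀ → ∀ x ∈ X K, ∀ j g, j < K → g ∈ admS (T K) (S K x) j → ∀ p ∈ (T K).branch j g,
      Integrable (fun y => χ K x j g p y * (T K).eterm (ρ₀ K t) j g y) (ν K j))
    (hPE : ∀ K t, |t| ≤ l₀ → ∀ x ∈ X K,
      PointwiseExtraction (T K) (S K x) K (χ K x) (M K x t) (fun j _ => a K x j))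
    (hLCS : ∀ K t, |t| ≤ l₀ → ∀ x ∈ X K,
      LocCondStability (T K) (S K x) K (ν K) (ρ₀ K t) (M K x t) (fun j _ => b K x j))
    (hint : ∀ K t, |t| ≤ l₀ → ∀ j g, j < K → g ∈ (T K).adm j → Integrable ((T K).eterm (ρ₀ K t) j g) (ν K j))
    (hint' : ∀ K t, |t| ≤ l₀ → ∀ j g p, j < K → g ∈ (T K).adm j → p ∈ (T K).branch j g →
      Integrable (((T K).op j g p).T ((T K).eterm (ρ₀ K t) j g)) (ν K (j + 1)))
    (hpres : ∀ K t, |t| ≤ l₀ → ∀ j g, j < K → g ∈ (T K).adm j →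
      ∫ x, (∑ p ∈ (T K).branch j g, ((T K).op j g p).T ((T K).eterm (ρ₀ K t) j g) x) ∂ν K (j + 1) =
        ∫ x, (T K).eterm (ρ₀ K t) j g x ∂ν K j)
    (hintM : ∀ K t, |t| ≤ l₀ → ∀ a', ∀ ι ∈ (skelFam T p₀ K).LIdx a',
      Integrable ((reprFam T p₀ ρ₀ hρ h0 B hB K t).eterm a' ι) (ν K K)) :
    ExtractionLaws l₀ (HIndex.termSet (skelFam T p₀))
      (fun _ t => Repr172R.weight (I := skelFam T p₀) (fun K => ν K K) (reprFam T p₀ ρ₀ hρ h0 B hB) t)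
      Bad X Badx (fun K x => ∏ j ∈ Finset.range K, exp (b K x j - a K x j)) :=
  extractionLaws_of_prefix_of_subset T p₀ ρ₀ hρ h0 B hB ν S (fun K x j => exp (b K x j - a K x j)) Bad X Badx hp₀
    (fun _ _ _ _ => (exp_pos _).le) bad_subset cover hread
    (fun K t ht x hx => hrel_of_LCS (hρ K t) (h0 K t) (hstep K t ht x hx) (hintχ K t ht x hx) (hPE K t ht x hx)
      (hLCS K t ht x hx))
    hint hint' hpres hintM

/-- The quotient of `extractionLaws_of_LCS_of_subset` in closed form: `Π_{j<K} e^{b − a} = e^{Σ_{j<K} (b − a)}`. [folklore] -/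
theorem prod_exp_sub_eq (K : ℕ) (x : α) :
    ∏ j ∈ Finset.range K, exp (b K x j - a K x j) = exp (∑ j ∈ Finset.range K, (b K x j - a K x j)) :=
  (exp_sum _ _).symm

end Laws

/-! ## §4 MODEL (one real Gaussian variable — says NOTHING about Bałaban's densities): the halved-action moment is `β`-free;
with an exterior mismatch it is `β`-uniform exactly when the mismatch is small in the scaled sense -/

section Model

/-- **THE PARTIAL GAUSSIAN MOMENT IS `β`-FREE**: for `0 < β` and `δ < 1`,
`∫ e^{δβx²}·e^{−βx²} dx = (√(1−δ))⁻¹ · ∫ e^{−βx²} dx` — sacrificing the fraction `δ` of a Gaussian action costs the factor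
`(1−δ)^{−1∕2}` per variable WHATEVER the coupling `β` (Dimock III (184) «W → √2 W takes us back to a probability measure», the
case `δ = ½`; the content of «LCS-j uniformly in β» in the simplest model). [folklore] -/
theorem gaussian_partial_moment {β δ : ℝ} (hβ : 0 < β) (hδ : δ < 1) :
    ∫ x : ℝ, exp (δ * β * x ^ 2) * exp (-β * x ^ 2) = (√(1 - δ))⁻¹ * ∫ x : ℝ, exp (-β * x ^ 2) := by
  have e : ∀ x : ℝ, exp (δ * β * x ^ 2) * exp (-β * x ^ 2) = exp (-((1 - δ) * β) * x ^ 2) := fun x => by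
    rw [← exp_add]; ring_nf
  simp_rw [e, integral_gaussian]
  have h1 : 0 < 1 - δ := by linarith
  rw [show π / ((1 - δ) * β) = (π / β) / (1 - δ) by field_simp, Real.sqrt_div' _ h1.le, div_eq_inv_mul]

/-- **WITH AN EXTERIOR MISMATCH `m`** (the variable's action is `β(x − m)²` against a reference Gaussian `e^{−βx²}`):
`∫ e^{δβ(x−m)²}·e^{−βx²} dx = (√(1−δ))⁻¹ · e^{δβm²∕(1−δ)} · ∫ e^{−βx²} dx` for `0 < β`, `δ < 1` — `β`-uniform if and only if
`β·m²` stays bounded, i.e. the exterior is SMALL-FIELD in the scaled sense `|m| ≲ β^{−1∕2}`; with a large-field exterior the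
moment grows like `e^{cβ}` and no extracted `e^{−p₀(g)}` beats it.  The located reason, in the simplest model, for print's
«denominators … determined by small field effective actions only» ([Balaban1989LargeFieldI] p. 177) and for the refuter's cost
item «(A1c) cover routing of births adjacent to live components» (PRICING-NE7b v61). [folklore] -/
theorem gaussian_partial_moment_shift {β δ : ℝ} (hβ : 0 < β) (hδ : δ < 1) (m : ℝ) :
    ∫ x : ℝ, exp (δ * β * (x - m) ^ 2) * exp (-β * x ^ 2) =
      (√(1 - δ))⁻¹ * exp (δ * β * m ^ 2 / (1 - δ)) * ∫ x : ℝ, exp (-β * x ^ 2) := by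
  have h1 : 0 < 1 - δ := by linarith
  have h1' : (1 - δ) ≠ 0 := h1.ne'
  -- complete the square: δβ(x−m)² − βx² = −(1−δ)β (x + δm∕(1−δ))² + δβm²∕(1−δ)
  have e : ∀ x : ℝ, exp (δ * β * (x - m) ^ 2) * exp (-β * x ^ 2) =
      exp (δ * β * m ^ 2 / (1 - δ)) * exp (-((1 - δ) * β) * (x + δ * m / (1 - δ)) ^ 2) := fun x => by
    rw [← exp_add, ← exp_add]
    congr 1
    field_simp
    ring
  simp_rw [e, integral_const_mul]
  rw [integral_add_right_eq_self (fun x : ℝ => exp (-((1 - δ) * β) * x ^ 2)) (δ * m / (1 - δ)), integral_gaussian,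
    integral_gaussian, show π / ((1 - δ) * β) = (π / β) / (1 - δ) by field_simp, Real.sqrt_div' _ h1.le]
  ring

end Model

/-! ## §5 Sanity (decided toy; says NOTHING about Bałaban's objects): on `B16HistoryReprInstance.toyT` (one-point levels, Dirac mass;
`true ↦ ×2`, `false ↦ ×3`; `ρ₀ ≡ 1`) `hstep` holds with the CONSTANT `χ true = 2`, `χ false = 3`; pin step `0` to `false` (`toyS`): both
halves hold with `a ≡ 0`, carrier `M = 3` resp. `5`, `b = log 3` resp. `log 5`, cost–volume constant `c = −(log 3 + log 5)`, and
`sum_admS_integral_le_of_LCS` gives `≤ e^{log 3 + log 5}·1 = 15` — ATTAINED (`PrefixExtractionLaws.toy_sum_admS`): jointly inhabited, sharp. -/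

section Sanity

/-- toy `hstep` characteristic functions: the constants `2` (choice `true`) and `3` (choice `false`). [folklore] -/
def toyχ : (j : ℕ) → (Fin j → Bool) → Bool → Unit → ℝ := fun _ _ p _ => if p then 2 else 3
/-- toy moment carrier: `3` at the pinned step `0`, `5` at the free step. [folklore] -/
def toyM : (j : ℕ) → (Fin j → Bool) → Unit → ℝ := fun j _ _ => if j = 0 then 3 else 5

/-- (S) THE CLASS BOUND FROM THE TWO HALVES ON THE TOY, NON-VACUOUSLY: `15 ≤ e^{−(−(log 3 + log 5))}·1 (= 15)`. [folklore] -/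
example : ∑ h ∈ admS toyT toyS 2, ∫ x, toyT.eterm (fun _ => (1 : ℝ)) 2 h x ∂(Measure.dirac ()) ≤
    exp (-(-(Real.log 3 + Real.log 5))) * ∫ x, (fun _ => (1 : ℝ)) x ∂(Measure.dirac ()) := by
  refine sum_admS_integral_le_of_LCS (T := toyT) (S := toyS) (μ := fun _ => Measure.dirac ()) (K := 2) (χ := toyχ)
    (M := toyM) (a := fun _ _ => 0) (b := fun j _ => if j = 0 then Real.log 3 else Real.log 5) trivial
    (fun _ => zero_le_one) ?_ ?_ ?_ ?_ ?_
  · -- `hstep`: `∫ (×c) f dδ = ∫ c·f dδ`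
    intro j g _ _ p _ f _
    cases p <;> simp [toyT, toyOps, toyOp, toyχ]
  · exact fun _ _ _ _ _ _ => Integrable.of_finite
  · -- `PointwiseExtraction`: step 0 pinned (`3 ≤ 1·3`), step 1 free (`2 + 3 ≤ 1·5`)
    intro j g hj _ y
    interval_cases j
    · simp [toyT, toyS, toyχ, toyM]
    · simp [toyT, toyS, toyχ, toyM]
      norm_num
  · -- `LocCondStability`: integrable (finite type) and `∫ M·e dδ ≤ e^{log M}·∫ e dδ`, an equality
    intro j g hj _
    refine ⟨Integrable.of_finite, ?_⟩
    interval_cases j <;>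
      simp [toyM, Real.exp_log (by norm_num : (0 : ℝ) < 3), Real.exp_log (by norm_num : (0 : ℝ) < 5)]
  · -- the cost–volume constant along every pattern history of length 2
    intro h _
    simp [sumAlong]

/-- (S') the right member IS `15`: `e^{log 3 + log 5} = 15` (so the bound of (S) is attained, by `PrefixExtractionLaws.toy_sum_admS`). [folklore] -/
example : exp (-(-(Real.log 3 + Real.log 5))) * ∫ x, (fun _ => (1 : ℝ)) x ∂(Measure.dirac ()) = 15 := by
  rw [neg_neg, exp_add, Real.exp_log (by norm_num : (0 : ℝ) < 3), Real.exp_log (by norm_num : (0 : ℝ) < 5)]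
  simp
  norm_num

end Sanity

end Summit.QuantumFields.BalabanUV.T4Continuum.NE7b.LocalConditionalStability
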